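import Summits.BirchSwinnertonDyer.BirchSwinnertonDyer.Theorems.ThetaPartnerAtTwoSignedMainConjectureCMTwoRankZeroFlatTwistImaginary
import Literature.NumberTheory.EllipticCurves.PAdicLFunctionQuadraticTwistBirchPeriodProofs
import Literature.NumberTheory.EllipticCurves.CuspFormTwistRatMinusSymbol
import Literature.NumberTheory.EllipticCurves.Kato2004.ValueGuardSatisfiableProofs
import HarnessLib

/-!
# Road (C) `disegni-pair-two` on crux stmt-BirchSwinnertonDyer-20368 — Birch's lemma for the MINUS symbols of the newforms of `E`
# and `E^{(d)}` WITH THE PERIOD CONSTANT (both signs of `d`): the symbol-level input of the odd-class period transport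

Cell `bsd-print-cf2`, width seat `bsd-line-cf2-p1-w8` g24; gap T⁻⁻ (i) of memo `Cruxes/SplitBadTwoRankOneOfFacts/PERIOD-CANCELS-w8g24.md` §6.
`--supports stmt-BirchSwinnertonDyer-20368` (helper). THEOREMS ONLY (no `def`, no named fact, no `sorry`); conditional on modularity
`exists_isNewformOf`. BSD is not proved by any of this; no summit statement is claimed; 20368 is not closed here.

The odd classes `d* ∈ {−1, −2}` of the road read the MINUS branch `L⁻₂(f_V, α_V, ω, ·)` and the minus period ratio
`μ_V·|Ω⁻(V)| = Ω⁻_{f_V}` of the good curve `V = E^{(d)}`. Transporting `μ_V` to the base needs Birch's lemma for the MINUS symbols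
of the pair `(f_E, f_V)` with its period constant — the minus twins of `exists_ratPlusSymbol_twist_eq_sum_and_sq` (`d > 0`) and of
`FlatTwist.Imaginary.exists_ratPlusSymbol_negTwist_eq_sum_and_sq` (`d < 0`), from the tree's new
`exists_rat_forall_ratMinusSymbol_charTwist_eq[_of_odd]` (`CuspFormTwistRatMinusSymbol`):

* ★★ `exists_ratMinusSymbol_twist_eq_sum_and_sq` (`d > 0`, `χ_d` even): ONE `c` with
  `[x]⁻_{f_A} = c·Σ_b (b/d)[x + b/d]⁻_{f_W}` and, as soon as some `[x]⁻_{f_A} ≠ 0`, `c²·d·(Ω⁻_{f_A})² = (Ω⁻_{f_W})²`;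
* ★★ `exists_ratMinusSymbol_negTwist_eq_sum_and_sq` (`d < 0`, `χ_d` odd): ONE `c` with
  `[x]⁻_{f_A} = c·Σ_b (b/|d|)[x + b/|d|]⁺_{f_W}` and, as soon as some `[x]⁻_{f_A} ≠ 0`, `c²·|d|·(Ω⁻_{f_A})² = (Ω⁺_{f_W})²`
  (`c·Ω⁻_{f_A}·i·g = Ω⁺_{f_W}`, `g² = −|d|`, `i² = −1`);
* `exists_ratMinusSymbol_ne_zero'` — the trigger `∃ x, [x]⁻_{f_A} ≠ 0` holds for every rational newform
  (`Kato2004.exists_ratMinusSymbol_ne_zero` re-exported in the road's namespace).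

References: B. Mazur, J. Tate, J. Teitelbaum, Invent. Math. 84 (1986) §I.8 [MazurTateTeitelbaum1986Invent]; G. Shimura (1971)
Prop. 3.64 [Shimura1971]; K. Ireland, M. Rosen, GTM 84, Prop. 8.2.2 [IrelandRosen1990].
-/

set_option autoImplicit false
set_option linter.dupNamespace false

noncomputable section

open scoped Classical MatrixGroups ModularForm NumberField NumberTheorySymbols

open CongruenceSubgroup WeierstrassCurve Literature.NumberTheory.EllipticCurves
  Literature.NumberTheory.EllipticCurves.ModularForms
  Summit.BirchSwinnertonDyer.BirchSwinnertonDyer.Theorems.FlatTwist.Imaginary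

namespace Summit.BirchSwinnertonDyer.BirchSwinnertonDyer.Theorems.PrintCf2.DisegniPairTwo

section MinusBirchPeriod

variable (W : WeierstrassCurve ℚ) [W.IsElliptic] {d : ℤ} {A : WeierstrassCurve ℚ} [A.IsElliptic]
  [NeZero (W.conductorNorm ℤ)] [NeZero (A.conductorNorm ℤ)] [NeZero d.natAbs]
  {fW : CuspForm (Gamma0 (W.conductorNorm ℤ)) 2} {fA : CuspForm (Gamma0 (A.conductorNorm ℤ)) 2}

/-- ★★ **Birch's lemma for the MINUS symbols of `(f_W, f_A)`, `A = W^{(d)}`, `d > 0`, WITH the period constant.** For `d > 0`,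
`d ≡ 1 (mod 4)` squarefree, `(d, N_W) = 1`: ONE `c ∈ ℚ` with `[x]⁻_{f_A} = c · Σ_{b mod d} (b/d)·[x + b/d]⁻_{f_W}` for every `x`,
and, as soon as some `[x]⁻_{f_A} ≠ 0`, `c²·d·(Ω⁻_{f_A})² = (Ω⁻_{f_W})²` (`c·Ω⁻_{f_A}·g = Ω⁻_{f_W}`, `g² = d`).
[cite: MazurTateTeitelbaum1986Invent, §I.8] [cite: Shimura1971, Prop. 3.64] -/
theorem exists_ratMinusSymbol_twist_eq_sum_and_sq (hmod : exists_isNewformOf) (hd : 0 < d) (hd4 : d % 4 = 1)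
    (hsq : Squarefree d) (hcop : IsCoprime d (W.conductorNorm ℤ : ℤ)) {C : VariableChange ℚ}
    (hA : C • W.quadraticTwist (d : ℚ) = A) (hfW : IsNewformOf W fW) (hfA : IsNewformOf A fA)
    {χ : MulChar (ZMod d.natAbs) ℤ} (hχ : ∀ a : ZMod d.natAbs, χ a = J((a.val : ℤ) | d.natAbs)) :
    ∃ c : ℚ, (∀ x : ℚ, ratMinusSymbol fA x =
        c * ∑ b : ZMod d.natAbs, (χ.ringHomComp (Int.castRingHom ℚ)) b * ratMinusSymbol fW (x + (b.val : ℚ) / d.natAbs)) ∧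
      ((∃ x : ℚ, ratMinusSymbol fA x ≠ 0) → (c : ℝ) ^ 2 * (d : ℝ) * minusPeriod fA ^ 2 = minusPeriod fW ^ 2) := by
  have hmd : (d.natAbs : ℤ) = d := Int.natAbs_of_nonneg hd.le
  have hodd : Odd d.natAbs := Int.natAbs_odd.mpr (Int.odd_iff.mpr (by omega))
  have hsq' : Squarefree d.natAbs := Int.squarefree_natAbs.mpr hsq
  have hm4 : d.natAbs % 4 = 1 := by omega
  obtain ⟨hq, hprim⟩ := mulChar_jacobi_complex_isQuadratic_isPrimitive hχ hodd hsq'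
  have heven : DirichletCharacter.Even (χ.ringHomComp (Int.castRingHom ℂ)) := by
    show (χ.ringHomComp (Int.castRingHom ℂ)) (-1) = 1
    rw [MulChar.ringHomComp_apply, mulChar_jacobi_apply_neg_one hχ hm4, map_one]
  have hg2 := gaussSum_jacobi_sq_eq hd hd4 hsq hχ
  have hNA := conductorNorm_twist_eq W hmod hd4 hsq hcop hA
  have hN : W.conductorNorm ℤ ∣ A.conductorNorm ℤ := ⟨d.natAbs ^ 2, hNA⟩
  have hm : d.natAbs ^ 2 ∣ A.conductorNorm ℤ := ⟨W.conductorNorm ℤ, by rw [hNA, mul_comm]⟩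
  have hFA := isNewformOf_twist_eq_charTwist W hd4 hsq hcop hA hfW hfA hχ hq hprim hN hm
  subst hFA
  obtain ⟨c, hc, hper⟩ := exists_rat_forall_ratMinusSymbol_charTwist_eq (A.conductorNorm ℤ) hN hm hq heven hprim
    hfW.1 hfW.coeffField_eq_bot hfA.1 hfA.coeffField_eq_bot (fun u ↦ J((u.val : ℤ) | d.natAbs))
    (fun u ↦ by rw [MulChar.ringHomComp_apply, hχ, eq_intCast])
  have hsum : ∀ x : ℚ, ∑ b : ZMod d.natAbs, (χ.ringHomComp (Int.castRingHom ℚ)) b *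
      ratMinusSymbol fW (x + (b.val : ℚ) / d.natAbs) =
      ∑ u : ZMod d.natAbs, (J((u.val : ℤ) | d.natAbs) : ℚ) * ratMinusSymbol fW (x + twistShift u) := by
    intro x
    refine Finset.sum_congr rfl fun b _ ↦ ?_
    rw [MulChar.ringHomComp_apply, hχ, eq_intCast]
    rfl
  refine ⟨c, fun x ↦ by rw [hc x, hsum x], fun ⟨x, hx⟩ ↦ ?_⟩
  have hS : ∃ r : ℚ, ∑ u : ZMod d.natAbs, (J((u.val : ℤ) | d.natAbs) : ℚ) * ratMinusSymbol fW (r + twistShift u) ≠ 0 := by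
    refine ⟨x, fun h0 ↦ hx ?_⟩
    rw [hc x, h0, mul_zero]
  have hP := hper hS
  have hsqP := congrArg (fun z : ℂ ↦ z ^ 2) hP
  rw [mul_pow, mul_pow, hg2] at hsqP
  have hdZ : ((d.natAbs : ℤ) : ℂ) = (d : ℂ) := congrArg (Int.cast : ℤ → ℂ) hmd
  have hdC : ((d.natAbs : ℕ) : ℂ) = (d : ℂ) := by rw [← hdZ, Int.cast_natCast]
  rw [hdC] at hsqP
  apply Complex.ofReal_injective
  push_cast
  linear_combination hsqP

/-- ★★ **Birch's lemma for the MINUS symbols of `(f_W, f_A)`, `A = W^{(d)}`, `d < 0`, WITH the period constant.** For `d < 0`,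
`d ≡ 1 (mod 4)` squarefree, `(d, N_W) = 1`: ONE `c ∈ ℚ` with `[x]⁻_{f_A} = c · Σ_{b mod |d|} (b/|d|)·[x + b/|d|]⁺_{f_W}` (PLUS symbols
of `f_W`) for every `x`, and, as soon as some `[x]⁻_{f_A} ≠ 0`, `c²·|d|·(Ω⁻_{f_A})² = (Ω⁺_{f_W})²` (`c·Ω⁻_{f_A}·i·g = Ω⁺_{f_W}`,
`g² = −|d|`, `i² = −1`). [cite: MazurTateTeitelbaum1986Invent, §I.8] [cite: Shimura1971, Prop. 3.64] [cite: IrelandRosen1990, Prop. 8.2.2] -/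
theorem exists_ratMinusSymbol_negTwist_eq_sum_and_sq (hmod : exists_isNewformOf) (hd : d < 0) (hd4 : d % 4 = 1)
    (hsq : Squarefree d) (hcop : IsCoprime d (W.conductorNorm ℤ : ℤ)) {C : VariableChange ℚ}
    (hA : C • W.quadraticTwist (d : ℚ) = A) (hfW : IsNewformOf W fW) (hfA : IsNewformOf A fA)
    {χ : MulChar (ZMod d.natAbs) ℤ} (hχ : ∀ a : ZMod d.natAbs, χ a = J((a.val : ℤ) | d.natAbs)) :
    ∃ c : ℚ, (∀ x : ℚ, ratMinusSymbol fA x =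
        c * ∑ b : ZMod d.natAbs, (J((b.val : ℤ) | d.natAbs) : ℚ) * ratPlusSymbol fW (x + (b.val : ℚ) / d.natAbs)) ∧
      ((∃ x : ℚ, ratMinusSymbol fA x ≠ 0) → (c : ℝ) ^ 2 * (d.natAbs : ℝ) * minusPeriod fA ^ 2 = plusPeriod fW ^ 2) := by
  have hodd : Odd d.natAbs := Int.natAbs_odd.mpr (Int.odd_iff.mpr (by omega))
  have hsq' : Squarefree d.natAbs := Int.squarefree_natAbs.mpr hsq
  have hm4 : d.natAbs % 4 = 3 := by omega
  obtain ⟨hq, hprim⟩ := mulChar_jacobi_complex_isQuadratic_isPrimitive hχ hodd hsq'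
  have hχodd : DirichletCharacter.Odd (χ.ringHomComp (Int.castRingHom ℂ)) := by
    show (χ.ringHomComp (Int.castRingHom ℂ)) (-1) = -1
    have h := mulChar_jacobi_apply_intCast hχ (-1)
    rw [Int.cast_neg, Int.cast_one] at h
    rw [MulChar.ringHomComp_apply, h, jacobiSym.at_neg_one hodd, ZMod.χ₄_nat_three_mod_four hm4]
    simp
  have hg2 := gaussSum_stdAddChar_sq_of_isQuadratic_of_odd hprim hq hχodd
  have hNA := conductorNorm_twist_eq W hmod hd4 hsq hcop hA
  have hN : W.conductorNorm ℤ ∣ A.conductorNorm ℤ := ⟨d.natAbs ^ 2, hNA⟩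
  have hm : d.natAbs ^ 2 ∣ A.conductorNorm ℤ := ⟨W.conductorNorm ℤ, by rw [hNA, mul_comm]⟩
  have hFA := isNewformOf_twist_eq_charTwist W hd4 hsq hcop hA hfW hfA hχ hq hprim hN hm
  subst hFA
  obtain ⟨c, hc, hper⟩ := exists_rat_forall_ratMinusSymbol_charTwist_eq_of_odd (A.conductorNorm ℤ) hN hm hq hχodd hprim
    hfW.1 hfW.coeffField_eq_bot hfA.1 hfA.coeffField_eq_bot (fun u ↦ J((u.val : ℤ) | d.natAbs))
    (fun u ↦ by rw [MulChar.ringHomComp_apply, hχ, eq_intCast])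
  have hsum : ∀ x : ℚ, ∑ b : ZMod d.natAbs, (J((b.val : ℤ) | d.natAbs) : ℚ) * ratPlusSymbol fW (x + (b.val : ℚ) / d.natAbs) =
      ∑ u : ZMod d.natAbs, (J((u.val : ℤ) | d.natAbs) : ℚ) * ratPlusSymbol fW (x + twistShift u) := fun x ↦ rfl
  refine ⟨c, fun x ↦ by rw [hc x, hsum x], fun ⟨x, hx⟩ ↦ ?_⟩
  have hS : ∃ r : ℚ, ∑ u : ZMod d.natAbs, (J((u.val : ℤ) | d.natAbs) : ℚ) * ratPlusSymbol fW (r + twistShift u) ≠ 0 := by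
    refine ⟨x, fun h0 ↦ hx ?_⟩
    rw [hc x, h0, mul_zero]
  have hP := hper hS
  have hsqP := congrArg (fun z : ℂ ↦ z ^ 2) hP
  rw [mul_pow, mul_pow, mul_pow, hg2, Complex.I_sq] at hsqP
  apply Complex.ofReal_injective
  push_cast
  linear_combination hsqP

omit [W.IsElliptic] [A.IsElliptic] [NeZero (W.conductorNorm ℤ)] [NeZero d.natAbs] in
/-- **The trigger `∃ x, [x]⁻_{f_A} ≠ 0` holds** for the newform of an elliptic curve (a rational newform has a period with
non-zero imaginary part; `Kato2004.exists_ratMinusSymbol_ne_zero`). [cite: MazurTateTeitelbaum1986Invent, §I.8] -/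
theorem exists_ratMinusSymbol_ne_zero' (hfA : IsNewformOf A fA) : ∃ x : ℚ, ratMinusSymbol fA x ≠ 0 :=
  Literature.NumberTheory.EllipticCurves.Kato2004.exists_ratMinusSymbol_ne_zero fA hfA.1 hfA.coeffField_eq_bot

end MinusBirchPeriod

end Summit.BirchSwinnertonDyer.BirchSwinnertonDyer.Theorems.PrintCf2.DisegniPairTwo

end
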